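import Summits.BirchSwinnertonDyer.BirchSwinnertonDyer.Theorems.ThetaPartnerAtTwoSignedKatoUpToAtTwoLocalTwoModel
import Literature.NumberTheory.EllipticCurves.Kobayashi2003.SignedSelmer
import HarnessLib

/-!
# Route `ThetaPartnerAtTwo` (TP2), crux K3 `SignedKatoDivisibilityUpToAtTwo` (item stmt-BirchSwinnertonDyer-20308),
# line `colemanrat` v3 — THE LOCAL THEORY AT `p = 2`, file 8: NO `2`-POWER TORSION IN `E(ℚ_{2,n})` along ANY
# `ℤ₂`-extension — Kobayashi's Prop. 8.7 at `p = 2` for the layer point groups `E(K_n·ℚ₂)` of the tree's signed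
# Selmer vocabulary (`Kobayashi2003.localLayerPointsOfEmb`), in K3's binders (`W` globally minimal, `GoodSS W 2`)

HONEST FRAMING (cell `bsd-wall`, lead `bsd-wall-tp2-p2x` g2): THEOREMS ONLY — no definition, no named fact, no
instance, no `sorry`; nothing about any Selmer group is asserted; closes no item; BSD is NOT proved by any of this.

## Why this file

Kobayashi's `±` theory over the cyclotomic `ℤ₂`-extension `ℚ_∞` (the habitat of K3: `SignedSelmerDualData W κ γ 1`,
`signedLocalPointsOfEmb κ ι W ε n ≤ localLayerPointsOfEmb κ ι W n = E(ℚ_{2,n})`) uses at every turn that the local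
layer points have no `2`-power torsion (Prop. 8.7: saturation of `E^±` in `E`, torsion-freeness of the local Iwasawa
cohomology, injectivity of the logarithm, the trace/injectivity argument of §8.4). File 4 proved `E^H[2^∞] = 0` for
every `H ≤ Gal(ℚ̄₂/ℚ₂)` of finite index prime to `3` on a good supersingular `ℤ₂`-model; file 6 built that model from
K3's binders. Here: the local layer subgroup `Gal(ℚ̄₂/K_n·ℚ₂)` of ANY `ℤ₂`-extension `κ` of `ℚ` has index dividing
`2ⁿ` (`Kobayashi2003.index_localLayerSubgroupOfEmb_dvd`), so **`E(K_n·ℚ₂)[2^∞] = 0` for every `n`** — for the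
cyclotomic `κ` this is `E(ℚ_{2,n})[2^∞] = 0`, `ℚ_{2,n} = ℚ₂(ζ_{2^{n+2}})⁺`, the ℤ₂-tower companion of file 5/6's
μ-tower statement (deviation (d2) of the port memo G2-PORT-AT-2.md §2).

## What is proved (`W/ℚ` globally minimal with `GoodSS W 2`; `Ω = ℚ̄₂`; points of `W` over `Ω` = `localPoints W ℚ_[2]`)

* `eq_zero_of_two_smul_eq_zero_of_forall_smul_eq` / `eq_zero_of_two_pow_smul_eq_zero_of_forall_smul_eq`: a point of
  `W(ℚ̄₂)` fixed by a subgroup `H ≤ Gal(ℚ̄₂/ℚ₂)` of finite index NOT divisible by `3` and killed by `2` (by `2^k`) is `O`.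
* `eq_zero_of_two_pow_smul_eq_zero_localLayerPointsOfEmb`: for EVERY `ℤ₂`-extension `κ` of `ℚ`, every
  `ι : ℚ̄ → ℚ̄₂` and every `n`, the layer point group `E(K_n·ℚ₂)` has no `2`-power torsion;
  `eq_zero_of_two_pow_smul_eq_zero_signedLocalPointsOfEmb`: hence neither has `E^ε(K_n·ℚ₂)`.

References: [Kobayashi2003] Prop. 8.7 (p. 16), Def. 1.1; [KuriharaOtsuki2006] Prop. 1.1; [SilvermanAEC2009] VII.3.
-/

set_option autoImplicit false
-- the Theorems namespace of this sub repeats the summit name by design (D-0017 nested layout)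
set_option linter.dupNamespace false

noncomputable section

open scoped Classical

namespace Summit.BirchSwinnertonDyer.BirchSwinnertonDyer.Theorems

namespace SignedKatoOffTwo.LocalTwo

open WeierstrassCurve Literature.NumberTheory.EllipticCurves Literature.NumberTheory.EllipticCurves.Rank1Residual
  Literature.NumberTheory.EllipticCurves.Kobayashi2003 Literature.NumberTheory.GaloisRepresentations

variable (W : WeierstrassCurve ℚ) [W.IsGloballyMinimal]

/-! ## §1 `W(ℚ̄₂)^H[2^∞] = 0` for `3 ∤ [Γ : H]` -/

/-- **A point of `W(ℚ̄₂)` fixed by `H ≤ Gal(ℚ̄₂/ℚ₂)`, `[Γ : H]` finite and prime to `3`, and killed by `2` is `O`**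
(`W` globally minimal, `GoodSS W 2`): file 4 on the model `M_W` of file 6, read on the tree's local points
`localPoints W ℚ_[2] = W(ℚ̄₂)` with their Galois action (`localPoints.smul_def`). [cite: Kobayashi2003, Prop. 8.7 (p. 16)] -/
theorem eq_zero_of_two_smul_eq_zero_of_forall_smul_eq (hss : GoodSS W 2)
    (H : Subgroup (Field.absoluteGaloisGroup ℚ_[2])) (hH0 : H.index ≠ 0) (hH : ¬ 3 ∣ H.index)
    {P : localPoints W ℚ_[2]} (hfix : ∀ τ ∈ H, τ • P = P) (hP : 2 • P = 0) : P = 0 := by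
  haveI := isElliptic_toZMod_twoAdicModel W hss.1
  rcases P with _ | ⟨x, y, hxy⟩
  · rfl
  exfalso
  refine two_smul_some_ne_zero_of_forall_apply_eq ((integralModelInt W).map (Int.castRingHom ℤ_[2]))
    (a₁_twoAdicModel_mem W hss) (baseChange_twoAdicModel W) H hH0 hH (fun σ hσ ↦ ?_) hP
  have h := hfix σ hσ
  rw [localPoints.smul_def, WeierstrassCurve.Affine.Point.map_some] at h
  exact (WeierstrassCurve.Affine.Point.some.inj h).1

/-- The same for `2^k`-torsion (induction on `k`; `2^k • P` is again `H`-fixed). [cite: Kobayashi2003, Prop. 8.7 (p. 16)] -/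
theorem eq_zero_of_two_pow_smul_eq_zero_of_forall_smul_eq (hss : GoodSS W 2)
    (H : Subgroup (Field.absoluteGaloisGroup ℚ_[2])) (hH0 : H.index ≠ 0) (hH : ¬ 3 ∣ H.index)
    {P : localPoints W ℚ_[2]} (hfix : ∀ τ ∈ H, τ • P = P) {k : ℕ} (hP : 2 ^ k • P = 0) : P = 0 := by
  induction k generalizing P with
  | zero => rwa [pow_zero, one_smul] at hP
  | succ k ih =>
    have hfix' : ∀ τ ∈ H, τ • (2 ^ k • P) = 2 ^ k • P := fun τ hτ ↦ by rw [smul_comm, hfix τ hτ]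
    have h2 : 2 • (2 ^ k • P) = 0 := by rw [← mul_nsmul, ← pow_succ, hP]
    exact ih hfix (eq_zero_of_two_smul_eq_zero_of_forall_smul_eq W hss H hH0 hH hfix' h2)

/-! ## §2 The layer point groups `E(K_n·ℚ₂)` of a `ℤ₂`-extension -/

/-- **Kobayashi's Prop. 8.7 AT `p = 2` along ANY `ℤ₂`-extension of `ℚ`**: for `W/ℚ` globally minimal with `GoodSS W 2`,
`κ : ZpExtension ℚ 2`, an embedding `ι : ℚ̄ → ℚ̄₂` and every `n`, the layer point group `E(K_n·ℚ₂)`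
(`Kobayashi2003.localLayerPointsOfEmb κ ι W n`; for the cyclotomic `κ`: `E(ℚ_{2,n})`, `ℚ_{2,n} = ℚ₂(ζ_{2^{n+2}})⁺`) has
NO `2`-power torsion — its fixing group `Gal(ℚ̄₂/K_n·ℚ₂)` has index dividing `2ⁿ`, prime to `3`.
[cite: Kobayashi2003, Prop. 8.7 (p. 16) and Def. 1.1] -/
theorem eq_zero_of_two_pow_smul_eq_zero_localLayerPointsOfEmb (hss : GoodSS W 2) (κ : ZpExtension ℚ 2)
    (ι : AlgebraicClosure ℚ →ₐ[ℚ] AlgebraicClosure ℚ_[2]) (n : ℕ) {P : localPoints W ℚ_[2]}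
    (hP : P ∈ localLayerPointsOfEmb κ ι W n) {k : ℕ} (hk : 2 ^ k • P = 0) : P = 0 := by
  have hdvd : (localLayerSubgroupOfEmb κ ι n).index ∣ 2 ^ n := index_localLayerSubgroupOfEmb_dvd κ ι n
  refine eq_zero_of_two_pow_smul_eq_zero_of_forall_smul_eq W hss (localLayerSubgroupOfEmb κ ι n) ?_ ?_
    ((mem_localLayerPointsOfEmb_iff κ ι W n P).mp hP) hk
  · exact fun h0 ↦ (pow_ne_zero n two_ne_zero) (Nat.eq_zero_of_zero_dvd (h0 ▸ hdvd))
  · intro h3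
    have h32 : 3 ∣ 2 ^ n := h3.trans hdvd
    have := Nat.Prime.dvd_of_dvd_pow Nat.prime_three h32
    omega

/-- **Kobayashi's `E^ε(K_n·ℚ₂)` has no `2`-power torsion** (`signedLocalPointsOfEmb κ ι W ε n ≤ E(K_n·ℚ₂)`), `W` globally
minimal with `GoodSS W 2`, any `ℤ₂`-extension, any sign. [cite: Kobayashi2003, Def. 1.1 and Prop. 8.7] -/
theorem eq_zero_of_two_pow_smul_eq_zero_signedLocalPointsOfEmb (hss : GoodSS W 2) (κ : ZpExtension ℚ 2)
    (ι : AlgebraicClosure ℚ →ₐ[ℚ] AlgebraicClosure ℚ_[2]) (ε : ℤˣ) (n : ℕ) {P : localPoints W ℚ_[2]}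
    (hP : P ∈ signedLocalPointsOfEmb κ ι W ε n) {k : ℕ} (hk : 2 ^ k • P = 0) : P = 0 :=
  eq_zero_of_two_pow_smul_eq_zero_localLayerPointsOfEmb W hss κ ι n (signedLocalPointsOfEmb_le κ ι W ε n hP) hk

end SignedKatoOffTwo.LocalTwo

end Summit.BirchSwinnertonDyer.BirchSwinnertonDyer.Theorems

end
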